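import Literature.Topology.FourManifolds.OneJetTransversality
import Mathlib.Analysis.Calculus.FDeriv.CompCLM
import Mathlib.Analysis.Normed.Operator.Bilinear
import HarnessLib

/-!
# Second-order genericity of maps `ℝ⁴ → ℝ²`: after almost every quadratic perturbation the
# degenerate critical points are nondegenerate zeros of the incidence system of `S_{1,1}` (Thom)

Topic `Literature/Topology/FourManifolds` (programme of the fact
`Literature.Topology.FourManifolds.exists_isSimplifiedBrokenLefschetzFibration`, Baykur–Saeki 2017, §2.1
p. 6: a generic map `X⁴ → Σ²` has *"only fold and cusp singularities"*, by *"a special case of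
Thom's transversality"*).  `OneJetTransversality.lean` dealt with the 1-jet (a.e. linear
perturbation: `dg ≠ 0` and `j¹g ⋔ S₁`); at a critical point of such a map either the kernel
Hessian `ℓ ∘ D²g(x)|_{Ker × Ker}` is nondegenerate (a fold point) or it has a radical line (a
cusp CANDIDATE, `OneJetFoldDichotomy.lean`).  The cusp candidates are the points of the
Thom–Boardman stratum `S_{1,1}(g)`; generically they are *simple cusps* (Golubitsky–Guillemin,
*Stable Mappings and Their Singularities* (1973), Ch. VI §2, Def. 2.3 and Thm. 2.4 (Whitney);
Ch. VI §4, `S_{r,s}`; §5 Thm. 5.2 (Boardman): *"the set `T_I` of `f` such that `j^k f ⋔ S_I`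
is a residual subset"* by the Thom transversality theorem II.4.9 for the 2-jet) — this is the
second-order half of B–S's "generic".

This file proves that second-order genericity in the finite-dimensional (Sard) form of the tree,
for the family of QUADRATIC perturbations `g = f + A + B(·, ·)` of a `C^∞` map
`f : ℝ⁴ ⊇ Ω → ℝ²` (`A` linear, `B` bilinear), through a determinant-free incidence
desingularisation of `S_{1,1}`: the square system in the nine unknowns
`u = (x, c, y, τ) ∈ ℝ⁴ × ℝ × ℝ³ × ℝ`

  `G(u) = ( ℓ_c ∘ dg_x ,  v ↦ ℓ_c(D²g(x)(v, k)) + τ · ℓ_B(dg_x v) ,  ℓ_B(dg_x k) ) ∈ (ℝ⁴)* × (ℝ⁴)* × ℝ`,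

where `ℓ_c = ℓ_A + c ℓ_B` runs over an affine chart of the cokernel covectors (`(ℓ_A, ℓ_B)` a
basis of `(ℝ²)*`) and `k = e_a + ∑ yᵢ e_{a↑i}` over an affine chart of the directions.  Its zeros
are exactly the data (critical point `x` with cokernel covector `ℓ_c`, radical direction `k` of
the kernel Hessian, multiplier `τ`) of the DEGENERATE critical points (`OneJet.oneOneSystem`,
`oneOneSystem_eq_zero_iff`); all entries are bilinear in the 1- and 2-jet.

* `OneJet.quadPerturb f θ = f + θ.1 + θ.2(·, ·)` and its jets (`fderiv_quadPerturb_of_mem`,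
  `fderiv_fderiv_quadPerturb_of_mem`, joint smoothness, parameter derivatives
  `jetOneParam`, `jetTwoParam`);
* `OneJet.surjective_oneOneParam` — **the parameter derivative of the system is onto `ℝ⁹` at
  every point** (1-jet directions realise `(ℓ_c ∘ N, ℓ_B ∘ N)` freely; bilinear directions
  with zero 1-jet at `x` adjust the middle block through a symmetric form with prescribed
  `b(·, k)`);
* **`OneJet.ae_surjective_fderiv_oneOneSystem`** — **for almost every `θ = (A, B)`** (any
  additive Haar measure on `Hom(ℝ⁴, ℝ²) × Bil(ℝ⁴ × ℝ⁴, ℝ²)`) **every zero `u` of the system of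
  `g = f + A + B(·,·)` with `x ∈ Ω` is nondegenerate: `D_u G` is onto (hence invertible,
  `9 × 9`)** — parametric transversality
  (`Literature.Analysis.Calculus.ParametricTransversality.ae_surjective_fderiv_section`, Sard).
  At the Morin cusp `(t, x³ + tx + y² - z²)` the system is nondegenerate, at the non-simple
  `(t, x⁴ + tx + y² - z²)` and at the non-transverse `(t, x³ + t²x + y² - z²)` it is not (ranks
  `9, 8, 8`): nondegeneracy of the system is the simple-cusp condition of GG VI Def. 2.3, whose
  extraction in rank-one coordinates (`∂³h/∂x₂³ ≠ 0`, GG p. 147) and the finiteness of the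
  cusp candidates are the next brick;
* `OneJet.ae_fderiv_quadPerturb_ne_zero`, `OneJet.ae_isOneJetTransverseAt_quadPerturb` — the
  first-order genericity of `OneJetTransversality.lean` for the same family (so that one `θ` does
  everything), `OneJet.ae_twoGeneric_quadPerturb` (all `4 × 2` incidence charts at once) and
  `OneJet.exists_norm_lt_twoGeneric` (**good `θ` of norm `< ε` exist**).

Everything here is proved; the definitions (`quadPerturb`, `flipL`, `jetOneParam`, `jetTwoParam`,
`radVec`, `Unknowns`, `Values`, `oneOneSystem`, `oneOneParam`) carry unfolding lemmas; no named
fact is introduced (D-0026).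

## References

* M. Golubitsky, V. Guillemin, *Stable Mappings and Their Singularities*, GTM 14 (1973): Ch. II
  §4, Thm. 4.9; Ch. VI §2, Def. 2.3, Thm. 2.4; §4 (the `S_{r,s}`); §5, Thm. 5.2.
  [GolubitskyGuillemin1973]
* M. W. Hirsch, *Differential Topology*, GTM 33 (1976), Ch. 3 §2, Thm. 2.7. [HirschDT1976]
* J. Milnor, *Topology from the Differentiable Viewpoint* (1965), §3. [MilnorTDV1965]
* R. İ. Baykur, O. Saeki, *Simplifying indefinite fibrations on 4-manifolds*, arXiv:1705.11169,
  §2.1, p. 6. [BaykurSaeki2017]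
-/

noncomputable section

-- The normed structure on the nested space `E →L[ℝ] E →L[ℝ] F` of bilinear maps is two
-- instance syntheses deep (as in the tree's `YangMillsHeatFlowSemilinear`).
set_option maxSynthPendingDepth 2

open Set Function Filter MeasureTheory Module
open scoped ContDiff Topology

namespace Literature.Topology.FourManifolds

namespace OneJet

open Literature.Analysis.Calculus Literature.Analysis.Calculus.ParametricTransversality

/-! ### The quadratic perturbation family and its jets -/

section Quad

variable {E F : Type} [NormedAddCommGroup E] [NormedSpace ℝ E]
  [NormedAddCommGroup F] [NormedSpace ℝ F]

/-- The quadratic perturbation `f + A + B(·, ·)` of `f` by a linear map `A` and a bilinear map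
`B` (`θ = (A, B)`): the finite-dimensional family realising every 1-jet and every 2-jet at every
point, in which Thom's theorem for the 2-jet is applied. [cite: GolubitskyGuillemin1973, Ch. II §4, proof of Thm. 4.9] -/
def quadPerturb (f : E → F) (θ : (E →L[ℝ] F) × (E →L[ℝ] E →L[ℝ] F)) : E → F :=
  fun y => f y + θ.1 y + θ.2 y y

/-- Unfolding `quadPerturb`. [folklore] -/
@[simp]
theorem quadPerturb_apply (f : E → F) (θ : (E →L[ℝ] F) × (E →L[ℝ] E →L[ℝ] F)) (y : E) :
    quadPerturb f θ y = f y + θ.1 y + θ.2 y y :=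
  rfl

/-- The diagonal of a bilinear map, `y ↦ B y y`, has derivative `v ↦ B y v + B v y`. [folklore] -/
theorem hasFDerivAt_bilin_diag (B : E →L[ℝ] E →L[ℝ] F) (y : E) :
    HasFDerivAt (fun y => B y y) (B y + B.flip y) y := by
  have h := (B.hasFDerivAt (x := y)).clm_apply (hasFDerivAt_id y)
  refine h.congr_fderiv ?_
  ext v
  simp

/-- The derivative `y ↦ B y + Bᵀ y` of the diagonal is linear, with derivative `B + Bᵀ`.
[folklore] -/
theorem hasFDerivAt_bilin_diag_fderiv (B : E →L[ℝ] E →L[ℝ] F) (y : E) :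
    HasFDerivAt (fun y => B y + B.flip y) (B + B.flip) y := by
  have h := (B.hasFDerivAt (x := y)).add (B.flip.hasFDerivAt (x := y))
  exact h

/-- `y ↦ B y y` is `C^∞`. [folklore] -/
theorem contDiff_bilin_diag (B : E →L[ℝ] E →L[ℝ] F) : ContDiff ℝ ∞ fun y => B y y :=
  B.contDiff.clm_apply contDiff_id

/-- **The differential of the quadratic perturbation**:
`d(f + A + B(·,·))_y = df_y + A + B y + Bᵀ y`. [folklore] -/
theorem hasFDerivAt_quadPerturb {f : E → F} {y : E} (hf : DifferentiableAt ℝ f y)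
    (θ : (E →L[ℝ] F) × (E →L[ℝ] E →L[ℝ] F)) :
    HasFDerivAt (quadPerturb f θ) (fderiv ℝ f y + θ.1 + (θ.2 y + θ.2.flip y)) y := by
  unfold quadPerturb
  exact (hf.hasFDerivAt.add θ.1.hasFDerivAt).add (hasFDerivAt_bilin_diag θ.2 y)

/-- `fderiv` of the quadratic perturbation on an open set of smoothness. [folklore] -/
theorem fderiv_quadPerturb_of_mem {f : E → F} {Ω : Set E} (hΩ : IsOpen Ω)
    (hf : ContDiffOn ℝ ∞ f Ω) (θ : (E →L[ℝ] F) × (E →L[ℝ] E →L[ℝ] F)) {y : E} (hy : y ∈ Ω) :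
    fderiv ℝ (quadPerturb f θ) y = fderiv ℝ f y + θ.1 + (θ.2 y + θ.2.flip y) :=
  (hasFDerivAt_quadPerturb ((hf.contDiffAt (hΩ.mem_nhds hy)).differentiableAt (by simp)) θ).fderiv

/-- The quadratic perturbation is `C^∞` where `f` is. [folklore] -/
theorem contDiffOn_quadPerturb {f : E → F} {Ω : Set E} (hf : ContDiffOn ℝ ∞ f Ω)
    (θ : (E →L[ℝ] F) × (E →L[ℝ] E →L[ℝ] F)) : ContDiffOn ℝ ∞ (quadPerturb f θ) Ω := by
  unfold quadPerturb
  exact (hf.add θ.1.contDiff.contDiffOn).add (contDiff_bilin_diag θ.2).contDiffOn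

/-- **The second differential of the quadratic perturbation**: `D²(f + A + B(·,·))_y = D²f_y +
(B + Bᵀ)`, on an open set of smoothness. [folklore] -/
theorem fderiv_fderiv_quadPerturb_of_mem {f : E → F} {Ω : Set E} (hΩ : IsOpen Ω)
    (hf : ContDiffOn ℝ ∞ f Ω) (θ : (E →L[ℝ] F) × (E →L[ℝ] E →L[ℝ] F)) {y : E} (hy : y ∈ Ω) :
    fderiv ℝ (fderiv ℝ (quadPerturb f θ)) y = fderiv ℝ (fderiv ℝ f) y + (θ.2 + θ.2.flip) := by
  have heq : fderiv ℝ (quadPerturb f θ) =ᶠ[𝓝 y]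
      fun z => fderiv ℝ f z + θ.1 + (θ.2 z + θ.2.flip z) := by
    filter_upwards [hΩ.mem_nhds hy] with z hz
    exact fderiv_quadPerturb_of_mem hΩ hf θ hz
  rw [heq.fderiv_eq]
  have hf' : ContDiffOn ℝ ∞ (fderiv ℝ f) Ω := hf.fderiv_of_isOpen hΩ (by simp)
  have hd : HasFDerivAt (fderiv ℝ f) (fderiv ℝ (fderiv ℝ f) y) y :=
    ((hf'.contDiffAt (hΩ.mem_nhds hy)).differentiableAt (by simp)).hasFDerivAt
  exact ((hd.add_const θ.1).add (hasFDerivAt_bilin_diag_fderiv θ.2 y)).fderiv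

/-- The flip of bilinear maps, as a continuous linear map. [folklore] -/
def flipL : (E →L[ℝ] E →L[ℝ] F) →L[ℝ] (E →L[ℝ] E →L[ℝ] F) :=
  ((ContinuousLinearMap.flipₗᵢ ℝ E E F).toContinuousLinearEquiv : _ →L[ℝ] _)

/-- `flipL B = Bᵀ`. [folklore] -/
@[simp]
theorem flipL_apply (B : E →L[ℝ] E →L[ℝ] F) : flipL B = B.flip := rfl

/-- **The parameter derivative of the 1-jet**: `(Ȧ, Ḃ) ↦ Ȧ + Ḃ y + Ḃᵀ y`. [folklore] -/
def jetOneParam (y : E) :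
    ((E →L[ℝ] F) × (E →L[ℝ] E →L[ℝ] F)) →L[ℝ] (E →L[ℝ] F) :=
  ContinuousLinearMap.fst ℝ _ _ +
    ((ContinuousLinearMap.apply ℝ (E →L[ℝ] F) y).comp (ContinuousLinearMap.snd ℝ _ _) +
      (ContinuousLinearMap.apply ℝ (E →L[ℝ] F) y).comp (flipL.comp (ContinuousLinearMap.snd ℝ _ _)))

/-- `jetOneParam y (Ȧ, Ḃ) = Ȧ + (Ḃ y + Ḃᵀ y)`. [folklore] -/
@[simp]
theorem jetOneParam_apply (y : E) (θ : (E →L[ℝ] F) × (E →L[ℝ] E →L[ℝ] F)) :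
    jetOneParam y θ = θ.1 + (θ.2 y + θ.2.flip y) := by
  simp [jetOneParam]

variable (E F) in
/-- **The parameter derivative of the 2-jet**: `(Ȧ, Ḃ) ↦ Ḃ + Ḃᵀ`. [folklore] -/
def jetTwoParam : ((E →L[ℝ] F) × (E →L[ℝ] E →L[ℝ] F)) →L[ℝ] (E →L[ℝ] E →L[ℝ] F) :=
  ((ContinuousLinearMap.id ℝ (E →L[ℝ] E →L[ℝ] F) + flipL :
      (E →L[ℝ] E →L[ℝ] F) →L[ℝ] (E →L[ℝ] E →L[ℝ] F))).comp
    (ContinuousLinearMap.snd ℝ (E →L[ℝ] F) (E →L[ℝ] E →L[ℝ] F))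

/-- `jetTwoParam (Ȧ, Ḃ) = Ḃ + Ḃᵀ`. [folklore] -/
@[simp]
theorem jetTwoParam_apply (θ : (E →L[ℝ] F) × (E →L[ℝ] E →L[ℝ] F)) :
    jetTwoParam E F θ = θ.2 + θ.2.flip := by
  simp [jetTwoParam]

/-- **The 1-jet of the family is affine in the parameter**, with derivative `jetOneParam y`.
[folklore] -/
theorem hasFDerivAt_fderiv_quadPerturb_param {f : E → F} {Ω : Set E} (hΩ : IsOpen Ω)
    (hf : ContDiffOn ℝ ∞ f Ω) {y : E} (hy : y ∈ Ω) (θ : (E →L[ℝ] F) × (E →L[ℝ] E →L[ℝ] F)) :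
    HasFDerivAt (fun ϑ => fderiv ℝ (quadPerturb f ϑ) y) (jetOneParam y) θ := by
  have heq : (fun ϑ : (E →L[ℝ] F) × (E →L[ℝ] E →L[ℝ] F) => fderiv ℝ (quadPerturb f ϑ) y) =
      fun ϑ => fderiv ℝ f y + jetOneParam y ϑ := by
    funext ϑ
    rw [fderiv_quadPerturb_of_mem hΩ hf ϑ hy, jetOneParam_apply, add_assoc]
  rw [heq]
  have hj : HasFDerivAt
      (fun ϑ : (E →L[ℝ] F) × (E →L[ℝ] E →L[ℝ] F) => jetOneParam (F := F) y ϑ)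
      (jetOneParam (F := F) y) θ :=
    (jetOneParam (F := F) y).hasFDerivAt
  exact hj.const_add (fderiv ℝ f y)

/-- **The 2-jet of the family is affine in the parameter**, with derivative `jetTwoParam`.
[folklore] -/
theorem hasFDerivAt_fderiv_fderiv_quadPerturb_param {f : E → F} {Ω : Set E} (hΩ : IsOpen Ω)
    (hf : ContDiffOn ℝ ∞ f Ω) {y : E} (hy : y ∈ Ω) (θ : (E →L[ℝ] F) × (E →L[ℝ] E →L[ℝ] F)) :
    HasFDerivAt (fun ϑ => fderiv ℝ (fderiv ℝ (quadPerturb f ϑ)) y) (jetTwoParam E F) θ := by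
  have heq : (fun ϑ : (E →L[ℝ] F) × (E →L[ℝ] E →L[ℝ] F) =>
      fderiv ℝ (fderiv ℝ (quadPerturb f ϑ)) y) =
      fun ϑ => fderiv ℝ (fderiv ℝ f) y + jetTwoParam E F ϑ := by
    funext ϑ
    rw [fderiv_fderiv_quadPerturb_of_mem hΩ hf ϑ hy, jetTwoParam_apply]
  rw [heq]
  have hj : HasFDerivAt
      (fun ϑ : (E →L[ℝ] F) × (E →L[ℝ] E →L[ℝ] F) => jetTwoParam E F ϑ) (jetTwoParam E F) θ :=
    (jetTwoParam E F).hasFDerivAt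
  exact hj.const_add (fderiv ℝ (fderiv ℝ f) y)

/-- **Joint smoothness of the 1-jet** of the family in `(θ, y)` on `univ × Ω`. [folklore] -/
theorem contDiffOn_fderiv_quadPerturb {f : E → F} {Ω : Set E} (hΩ : IsOpen Ω)
    (hf : ContDiffOn ℝ ∞ f Ω) :
    ContDiffOn ℝ ∞ (fun z : ((E →L[ℝ] F) × (E →L[ℝ] E →L[ℝ] F)) × E =>
      fderiv ℝ (quadPerturb f z.1) z.2) (univ ×ˢ Ω) := by
  have hf' : ContDiffOn ℝ ∞ (fderiv ℝ f) Ω := hf.fderiv_of_isOpen hΩ (by simp)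
  have heq : ∀ z ∈ (univ : Set ((E →L[ℝ] F) × (E →L[ℝ] E →L[ℝ] F))) ×ˢ Ω,
      fderiv ℝ (quadPerturb f z.1) z.2 = fderiv ℝ f z.2 + jetOneParam z.2 z.1 := fun z hz => by
    rw [fderiv_quadPerturb_of_mem hΩ hf z.1 hz.2, jetOneParam_apply, add_assoc]
  refine ContDiffOn.congr ?_ heq
  have hsnd : MapsTo (Prod.snd : ((E →L[ℝ] F) × (E →L[ℝ] E →L[ℝ] F)) × E → E) (univ ×ˢ Ω) Ω :=
    fun z hz => hz.2
  refine (hf'.comp contDiffOn_snd hsnd).add ?_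
  -- `(θ, y) ↦ θ.1 + θ.2 y + θ.2ᵀ y` is polynomial
  have h1 : ContDiff ℝ ∞ fun z : ((E →L[ℝ] F) × (E →L[ℝ] E →L[ℝ] F)) × E => z.1.1 :=
    contDiff_fst.comp contDiff_fst
  have h2 : ContDiff ℝ ∞ fun z : ((E →L[ℝ] F) × (E →L[ℝ] E →L[ℝ] F)) × E => z.1.2 z.2 :=
    (contDiff_snd.comp contDiff_fst).clm_apply contDiff_snd
  have hflip : ContDiff ℝ ∞ fun B : E →L[ℝ] E →L[ℝ] F => B.flip :=
    (ContinuousLinearMap.flipₗᵢ ℝ E E F).contDiff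
  have h3 : ContDiff ℝ ∞ fun z : ((E →L[ℝ] F) × (E →L[ℝ] E →L[ℝ] F)) × E => z.1.2.flip z.2 :=
    (hflip.comp (contDiff_snd.comp contDiff_fst)).clm_apply contDiff_snd
  have : (fun z : ((E →L[ℝ] F) × (E →L[ℝ] E →L[ℝ] F)) × E => jetOneParam z.2 z.1) =
      fun z => z.1.1 + (z.1.2 z.2 + z.1.2.flip z.2) := by
    funext z; rw [jetOneParam_apply]
  rw [this]
  exact (h1.add (h2.add h3)).contDiffOn

/-- **Joint smoothness of the 2-jet** of the family in `(θ, y)` on `univ × Ω`. [folklore] -/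
theorem contDiffOn_fderiv_fderiv_quadPerturb {f : E → F} {Ω : Set E} (hΩ : IsOpen Ω)
    (hf : ContDiffOn ℝ ∞ f Ω) :
    ContDiffOn ℝ ∞ (fun z : ((E →L[ℝ] F) × (E →L[ℝ] E →L[ℝ] F)) × E =>
      fderiv ℝ (fderiv ℝ (quadPerturb f z.1)) z.2) (univ ×ˢ Ω) := by
  have hf' : ContDiffOn ℝ ∞ (fderiv ℝ f) Ω := hf.fderiv_of_isOpen hΩ (by simp)
  have hf'' : ContDiffOn ℝ ∞ (fderiv ℝ (fderiv ℝ f)) Ω := hf'.fderiv_of_isOpen hΩ (by simp)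
  have heq : ∀ z ∈ (univ : Set ((E →L[ℝ] F) × (E →L[ℝ] E →L[ℝ] F))) ×ˢ Ω,
      fderiv ℝ (fderiv ℝ (quadPerturb f z.1)) z.2 =
        fderiv ℝ (fderiv ℝ f) z.2 + jetTwoParam E F z.1 := fun z hz => by
    rw [fderiv_fderiv_quadPerturb_of_mem hΩ hf z.1 hz.2, jetTwoParam_apply]
  refine ContDiffOn.congr ?_ heq
  have hsnd : MapsTo (Prod.snd : ((E →L[ℝ] F) × (E →L[ℝ] E →L[ℝ] F)) × E → E) (univ ×ˢ Ω) Ω :=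
    fun z hz => hz.2
  have hj : ContDiff ℝ ∞ fun θ : (E →L[ℝ] F) × (E →L[ℝ] E →L[ℝ] F) => jetTwoParam E F θ :=
    (jetTwoParam E F).contDiff
  exact (hf''.comp contDiffOn_snd hsnd).add (hj.comp contDiff_fst).contDiffOn

end Quad

/-! ### The incidence system of `S_{1,1}` for maps `ℝ⁴ → ℝ²` -/

section System

/-- Local notation for this file: the model space `ℝⁿ = EuclideanSpace ℝ (Fin n)`. -/
local notation "𝔼 " n:arg => EuclideanSpace ℝ (Fin n)

/-- The affine chart of directions: `k = e_a + ∑ᵢ yᵢ e_{a.succAbove i}` (so `k_a = 1`). [folklore] -/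
def radVec (a : Fin 4) (y : 𝔼 3) : 𝔼 4 :=
  EuclideanSpace.single a (1 : ℝ) + ∑ i : Fin 3, y i • EuclideanSpace.single (a.succAbove i) (1 : ℝ)

/-- `(radVec a y)_a = 1`. [folklore] -/
theorem radVec_apply_self (a : Fin 4) (y : 𝔼 3) : radVec a y a = 1 := by
  simp [radVec, Finset.sum_apply]

/-- `y ↦ radVec a y` is affine, with derivative `ẏ ↦ ∑ ẏᵢ e_{a↑i}`. [folklore] -/
theorem hasFDerivAt_radVec (a : Fin 4) (y : 𝔼 3) :
    HasFDerivAt (radVec a)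
      (∑ i : Fin 3, (EuclideanSpace.proj i : 𝔼 3 →L[ℝ] ℝ).smulRight
        (EuclideanSpace.single (a.succAbove i) (1 : ℝ))) y := by
  unfold radVec
  refine (HasFDerivAt.fun_sum fun i _ => ?_).const_add _
  exact ((EuclideanSpace.proj i : 𝔼 3 →L[ℝ] ℝ).hasFDerivAt).smul_const _

/-- `radVec a` is `C^∞`. [folklore] -/
theorem contDiff_radVec (a : Fin 4) : ContDiff ℝ ∞ (radVec a) := by
  unfold radVec
  refine contDiff_const.add (ContDiff.sum fun i _ => ?_)
  exact (EuclideanSpace.proj i : 𝔼 3 →L[ℝ] ℝ).contDiff.smul contDiff_const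

/-- The unknowns of the system: `u = (x, c, y, τ)`. [folklore] -/
abbrev Unknowns : Type := 𝔼 4 × (ℝ × ((𝔼 3) × ℝ))

/-- The values of the system: `((ℝ⁴)*, (ℝ⁴)*, ℝ)`. [folklore] -/
abbrev Values : Type := (𝔼 4 →L[ℝ] ℝ) × ((𝔼 4 →L[ℝ] ℝ) × ℝ)

/-- **The incidence system of `S_{1,1}`** for a map `g : ℝ⁴ → ℝ²`, in the affine charts
`ℓ_c = ℓ_A + c ℓ_B` of cokernel covectors and `k = radVec a y` of directions:
`G(x, c, y, τ) = (ℓ_c ∘ dg_x, v ↦ ℓ_c(D²g(x)(v, k)) + τ ℓ_B(dg_x v), ℓ_B(dg_x k))`.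
[cite: GolubitskyGuillemin1973, Ch. VI §4 (the `S_{r,s}`), §3 (3.1)] -/
def oneOneSystem (ℓA ℓB : (𝔼 2) →L[ℝ] ℝ) (a : Fin 4) (g : 𝔼 4 → 𝔼 2) (u : Unknowns) : Values :=
  ((ℓA + u.2.1 • ℓB).comp (fderiv ℝ g u.1),
    ((ℓA + u.2.1 • ℓB).comp ((fderiv ℝ (fderiv ℝ g) u.1).flip (radVec a u.2.2.1)) +
        u.2.2.2 • ℓB.comp (fderiv ℝ g u.1),
      ℓB (fderiv ℝ g u.1 (radVec a u.2.2.1))))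

/-- Unfolding `oneOneSystem` at `u = (x, (c, (y, τ)))`. [folklore] -/
theorem oneOneSystem_apply (ℓA ℓB : (𝔼 2) →L[ℝ] ℝ) (a : Fin 4) (g : 𝔼 4 → 𝔼 2) (x : 𝔼 4)
    (c : ℝ) (y : 𝔼 3) (τ : ℝ) :
    oneOneSystem ℓA ℓB a g (x, (c, (y, τ))) =
      ((ℓA + c • ℓB).comp (fderiv ℝ g x),
        ((ℓA + c • ℓB).comp ((fderiv ℝ (fderiv ℝ g) x).flip (radVec a y)) +
            τ • ℓB.comp (fderiv ℝ g x),
          ℓB (fderiv ℝ g x (radVec a y)))) :=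
  rfl

/-- **What the zeros of the system are.**  `G(x, c, y, τ) = 0` iff `ℓ_c` kills `Im dg_x`
(`x` critical with cokernel covector `ℓ_c`), `ℓ_c(D²g(x)(v, k)) = -τ ℓ_B(dg_x v)` for all `v` —
in particular `k` is a radical vector of the kernel Hessian `ℓ_c ∘ D²g(x)` on `Ker dg_x` — and
`ℓ_B(dg_x k) = 0`, which with the first condition and `(ℓ_A, ℓ_B)` a basis puts `k` in `Ker dg_x`.
[cite: GolubitskyGuillemin1973, Ch. VI §4] -/
theorem oneOneSystem_eq_zero_iff (ℓA ℓB : (𝔼 2) →L[ℝ] ℝ) (a : Fin 4) (g : 𝔼 4 → 𝔼 2) (x : 𝔼 4)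
    (c : ℝ) (y : 𝔼 3) (τ : ℝ) :
    oneOneSystem ℓA ℓB a g (x, (c, (y, τ))) = 0 ↔
      (ℓA + c • ℓB).comp (fderiv ℝ g x) = 0 ∧
      (∀ v, (ℓA + c • ℓB) (fderiv ℝ (fderiv ℝ g) x v (radVec a y)) =
        -(τ * ℓB (fderiv ℝ g x v))) ∧
      ℓB (fderiv ℝ g x (radVec a y)) = 0 := by
  rw [oneOneSystem_apply, Prod.mk_eq_zero, Prod.mk_eq_zero]
  refine and_congr Iff.rfl (and_congr ?_ Iff.rfl)
  constructor
  · intro h v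
    have := congrArg (fun φ : 𝔼 4 →L[ℝ] ℝ => φ v) h
    simp only [_root_.add_apply, ContinuousLinearMap.comp_apply, ContinuousLinearMap.flip_apply,
      _root_.smul_apply, smul_eq_mul, _root_.zero_apply] at this
    rw [_root_.add_apply, _root_.smul_apply, smul_eq_mul]
    linarith
  · intro h
    ext v
    simp only [_root_.add_apply, ContinuousLinearMap.comp_apply, ContinuousLinearMap.flip_apply,
      _root_.smul_apply, smul_eq_mul, _root_.zero_apply, h v]
    ring

/-! ### The system of the quadratic family: smoothness and the parameter derivative -/

/-- Local notation: the parameter space `Hom(ℝ⁴, ℝ²) × Bil(ℝ⁴ × ℝ⁴, ℝ²)` of the quadratic family. -/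
local notation "P₂" => ((𝔼 4 →L[ℝ] 𝔼 2) × (𝔼 4 →L[ℝ] 𝔼 4 →L[ℝ] 𝔼 2))

/-- **Joint smoothness of the system** `(θ, u) ↦ G_{f + θ}(u)` on `univ × (Ω × univ)`. [folklore] -/
theorem contDiffOn_oneOneSystem {f : 𝔼 4 → 𝔼 2} {Ω : Set (𝔼 4)} (hΩ : IsOpen Ω)
    (hf : ContDiffOn ℝ ∞ f Ω) (ℓA ℓB : (𝔼 2) →L[ℝ] ℝ) (a : Fin 4) :
    ContDiffOn ℝ ∞ (fun z : P₂ × Unknowns => oneOneSystem ℓA ℓB a (quadPerturb f z.1) z.2)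
      (univ ×ˢ (Ω ×ˢ univ)) := by
  set Ω' : Set (P₂ × Unknowns) := univ ×ˢ (Ω ×ˢ univ) with hΩ'
  -- the jets, as functions of `(θ, u)`
  have hπ : ContDiff ℝ ∞ fun z : P₂ × Unknowns => (z.1, z.2.1) :=
    contDiff_fst.prodMk (contDiff_fst.comp contDiff_snd)
  have hπm : MapsTo (fun z : P₂ × Unknowns => (z.1, z.2.1)) Ω' (univ ×ˢ Ω) :=
    fun z hz => ⟨mem_univ _, hz.2.1⟩
  -- (`have … ; exact`: elaborating these compositions against the expected type is slow)
  have hJ₁ : ContDiffOn ℝ ∞ (fun z : P₂ × Unknowns => fderiv ℝ (quadPerturb f z.1) z.2.1) Ω' := by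
    have h := (contDiffOn_fderiv_quadPerturb hΩ hf).comp hπ.contDiffOn hπm
    exact h
  have hJ₂ : ContDiffOn ℝ ∞
      (fun z : P₂ × Unknowns => fderiv ℝ (fderiv ℝ (quadPerturb f z.1)) z.2.1) Ω' := by
    have h := (contDiffOn_fderiv_fderiv_quadPerturb hΩ hf).comp hπ.contDiffOn hπm
    exact h
  -- the affine data `ℓ_c`, `k`, `τ`
  have hc : ContDiff ℝ ∞ fun z : P₂ × Unknowns => ℓA + z.2.2.1 • ℓB :=
    contDiff_const.add ((contDiff_fst.comp (contDiff_snd.comp contDiff_snd)).smul contDiff_const)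
  have hk : ContDiff ℝ ∞ fun z : P₂ × Unknowns => radVec a z.2.2.2.1 :=
    (contDiff_radVec a).comp
      (contDiff_fst.comp (contDiff_snd.comp (contDiff_snd.comp contDiff_snd)))
  have hτ : ContDiff ℝ ∞ fun z : P₂ × Unknowns => z.2.2.2.2 :=
    contDiff_snd.comp (contDiff_snd.comp (contDiff_snd.comp contDiff_snd))
  have hflip : ContDiff ℝ ∞ fun B : 𝔼 4 →L[ℝ] 𝔼 4 →L[ℝ] 𝔼 2 => B.flip :=
    (ContinuousLinearMap.flipₗᵢ ℝ (𝔼 4) (𝔼 4) (𝔼 2)).contDiff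
  -- the three components
  have h1 : ContDiffOn ℝ ∞ (fun z : P₂ × Unknowns =>
      (ℓA + z.2.2.1 • ℓB).comp (fderiv ℝ (quadPerturb f z.1) z.2.1)) Ω' :=
    hc.contDiffOn.clm_comp hJ₁
  have h2a : ContDiffOn ℝ ∞ (fun z : P₂ × Unknowns =>
      (fderiv ℝ (fderiv ℝ (quadPerturb f z.1)) z.2.1).flip (radVec a z.2.2.2.1)) Ω' :=
    (hflip.comp_contDiffOn hJ₂).clm_apply hk.contDiffOn
  have h2 : ContDiffOn ℝ ∞ (fun z : P₂ × Unknowns =>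
      (ℓA + z.2.2.1 • ℓB).comp
          ((fderiv ℝ (fderiv ℝ (quadPerturb f z.1)) z.2.1).flip (radVec a z.2.2.2.1)) +
        z.2.2.2.2 • ℓB.comp (fderiv ℝ (quadPerturb f z.1) z.2.1)) Ω' :=
    (hc.contDiffOn.clm_comp h2a).add (hτ.contDiffOn.smul (contDiffOn_const.clm_comp hJ₁))
  have h3 : ContDiffOn ℝ ∞ (fun z : P₂ × Unknowns =>
      ℓB (fderiv ℝ (quadPerturb f z.1) z.2.1 (radVec a z.2.2.2.1))) Ω' :=
    contDiffOn_const.clm_apply (hJ₁.clm_apply hk.contDiffOn)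
  exact (h1.prodMk (h2.prodMk h3)).congr fun z _ => rfl

/-- **The parameter derivative of the system** at `u = (x, c, y, τ)`, as a continuous linear map of
the variation `ϑ = (Ȧ, Ḃ)`: the system built on the jets `(Ȧ + Ḃx + Ḃᵀx, Ḃ + Ḃᵀ)` of the
variation (`oneOneParam_apply`). [folklore] -/
def oneOneParam (ℓA ℓB : (𝔼 2) →L[ℝ] ℝ) (a : Fin 4) (x : 𝔼 4) (c : ℝ) (y : 𝔼 3) (τ : ℝ) :
    P₂ →L[ℝ] Values :=
  ((ContinuousLinearMap.compL ℝ (𝔼 4) (𝔼 2) ℝ (ℓA + c • ℓB)).comp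
      (jetOneParam (F := 𝔼 2) x)).prod
    (((ContinuousLinearMap.compL ℝ (𝔼 4) (𝔼 2) ℝ (ℓA + c • ℓB)).comp
          (((ContinuousLinearMap.apply ℝ (𝔼 4 →L[ℝ] 𝔼 2) (radVec a y)).comp flipL).comp
            (jetTwoParam (𝔼 4) (𝔼 2))) +
        (τ • ContinuousLinearMap.compL ℝ (𝔼 4) (𝔼 2) ℝ ℓB).comp (jetOneParam (F := 𝔼 2) x)).prod
      ((ℓB.comp (ContinuousLinearMap.apply ℝ (𝔼 2) (radVec a y))).comp
        (jetOneParam (F := 𝔼 2) x)))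

/-- `oneOneParam` in terms of the jets of the variation. [folklore] -/
theorem oneOneParam_apply (ℓA ℓB : (𝔼 2) →L[ℝ] ℝ) (a : Fin 4) (x : 𝔼 4) (c : ℝ) (y : 𝔼 3)
    (τ : ℝ) (ϑ : P₂) :
    oneOneParam ℓA ℓB a x c y τ ϑ =
      ((ℓA + c • ℓB).comp (jetOneParam x ϑ),
        ((ℓA + c • ℓB).comp ((jetTwoParam (𝔼 4) (𝔼 2) ϑ).flip (radVec a y)) +
            τ • ℓB.comp (jetOneParam x ϑ),
          ℓB (jetOneParam x ϑ (radVec a y)))) := by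
  simp only [oneOneParam, ContinuousLinearMap.prod_apply, ContinuousLinearMap.coe_comp,
    comp_apply, ContinuousLinearMap.compL_apply, ContinuousLinearMap.apply_apply, flipL_apply,
    _root_.add_apply, _root_.smul_apply]

/-- **The system of the family is differentiable in the parameter with derivative `oneOneParam`**
(it is affine in `θ`). [folklore] -/
theorem hasFDerivAt_oneOneSystem_param {f : 𝔼 4 → 𝔼 2} {Ω : Set (𝔼 4)} (hΩ : IsOpen Ω)
    (hf : ContDiffOn ℝ ∞ f Ω) (ℓA ℓB : (𝔼 2) →L[ℝ] ℝ) (a : Fin 4) {x : 𝔼 4} (hx : x ∈ Ω)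
    (c : ℝ) (y : 𝔼 3) (τ : ℝ) (θ : P₂) :
    HasFDerivAt (fun ϑ : P₂ => oneOneSystem ℓA ℓB a (quadPerturb f ϑ) (x, (c, (y, τ))))
      (oneOneParam ℓA ℓB a x c y τ) θ := by
  -- the section, written as continuous linear maps applied to the two jets
  set Lc := ContinuousLinearMap.compL ℝ (𝔼 4) (𝔼 2) ℝ (ℓA + c • ℓB) with hLc
  set Lk := (ContinuousLinearMap.apply ℝ (𝔼 4 →L[ℝ] 𝔼 2) (radVec a y)).comp
    (flipL (E := 𝔼 4) (F := 𝔼 2)) with hLk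
  set Lτ := τ • ContinuousLinearMap.compL ℝ (𝔼 4) (𝔼 2) ℝ ℓB with hLτ
  set Lρ := ℓB.comp (ContinuousLinearMap.apply ℝ (𝔼 2) (radVec a y)) with hLρ
  have hfun : (fun ϑ : P₂ => oneOneSystem ℓA ℓB a (quadPerturb f ϑ) (x, (c, (y, τ)))) =
      fun ϑ : P₂ => (Lc (fderiv ℝ (quadPerturb f ϑ) x),
        (Lc (Lk (fderiv ℝ (fderiv ℝ (quadPerturb f ϑ)) x)) + Lτ (fderiv ℝ (quadPerturb f ϑ) x),
          Lρ (fderiv ℝ (quadPerturb f ϑ) x))) := by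
    funext ϑ
    rfl
  have hpar : oneOneParam ℓA ℓB a x c y τ =
      (Lc.comp (jetOneParam (F := 𝔼 2) x)).prod
        ((Lc.comp (Lk.comp (jetTwoParam (𝔼 4) (𝔼 2))) + Lτ.comp (jetOneParam (F := 𝔼 2) x)).prod
          (Lρ.comp (jetOneParam (F := 𝔼 2) x))) := rfl
  rw [hfun, hpar]
  have hJ₁ := hasFDerivAt_fderiv_quadPerturb_param hΩ hf hx θ
  have hJ₂ := hasFDerivAt_fderiv_fderiv_quadPerturb_param hΩ hf hx θ
  have h1 := Lc.hasFDerivAt.comp θ hJ₁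
  have h2 := (Lc.hasFDerivAt.comp θ (Lk.hasFDerivAt.comp θ hJ₂)).add (Lτ.hasFDerivAt.comp θ hJ₁)
  have h3 := Lρ.hasFDerivAt.comp θ hJ₁
  exact h1.prodMk (h2.prodMk h3)

/-- **The parameter derivative of the system is onto, at every point.**  With `(u_A, u_B)` the
basis of `ℝ²` dual to `(ℓ_A, ℓ_B)` and `(ψ, χ, ρ)` a target value: `φ := ρ κ` (`κ` the `a`-th
coordinate, `κ(k) = 1`), `Ṅ := ψ ⊗ u_A + φ ⊗ (u_B - c u_A)` realises `ℓ_c ∘ Ṅ = ψ`, `ℓ_B ∘ Ṅ = φ`;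
the symmetric form `b := χ' ⊗ κ + κ ⊗ χ' - χ'(k) κ ⊗ κ` (`χ' := χ - τ φ`) has `b(·, k) = χ'`, and
`Ḃ := ½ b ⊗ u_A`, `Ȧ := Ṅ - Ḃx - Ḃᵀx` do it. [folklore] -/
theorem surjective_oneOneParam {ℓA ℓB : (𝔼 2) →L[ℝ] ℝ} {uA uB : 𝔼 2} (hA1 : ℓA uA = 1)
    (hB1 : ℓB uA = 0) (hA2 : ℓA uB = 0) (hB2 : ℓB uB = 1) (a : Fin 4) (x : 𝔼 4) (c : ℝ)
    (y : 𝔼 3) (τ : ℝ) : Surjective (oneOneParam ℓA ℓB a x c y τ) := by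
  rintro ⟨ψ, χ, ρ⟩
  -- the data
  set κ : 𝔼 4 →L[ℝ] ℝ := EuclideanSpace.proj a with hκ
  have hκk : κ (radVec a y) = 1 := by rw [hκ]; exact radVec_apply_self a y
  set φ : 𝔼 4 →L[ℝ] ℝ := ρ • κ with hφ
  set χ' : 𝔼 4 →L[ℝ] ℝ := χ - τ • φ with hχ'
  set N : 𝔼 4 →L[ℝ] 𝔼 2 := ψ.smulRight uA + φ.smulRight (uB - c • uA) with hN
  set b : 𝔼 4 →L[ℝ] 𝔼 4 →L[ℝ] ℝ :=
    (ContinuousLinearMap.mul ℝ ℝ).bilinearComp χ' κ + (ContinuousLinearMap.mul ℝ ℝ).bilinearComp κ χ'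
      - (χ' (radVec a y)) • (ContinuousLinearMap.mul ℝ ℝ).bilinearComp κ κ with hb
  set S : 𝔼 4 →L[ℝ] 𝔼 4 →L[ℝ] 𝔼 2 :=
    ((ContinuousLinearMap.smulRightL ℝ (𝔼 4) (𝔼 2)).flip uA).comp b with hS
  set B : 𝔼 4 →L[ℝ] 𝔼 4 →L[ℝ] 𝔼 2 := (1 / 2 : ℝ) • S with hB
  set A : 𝔼 4 →L[ℝ] 𝔼 2 := N - (B x + B.flip x) with hA
  refine ⟨(A, B), ?_⟩
  -- the jets of the variation
  have hJ1 : jetOneParam x (A, B) = N := by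
    rw [jetOneParam_apply]
    show A + (B x + B.flip x) = N
    rw [hA, sub_add_cancel]
  have hSvw : ∀ v w, S v w = b v w • uA := fun v w => by
    simp [hS]
  have hbsymm : ∀ v w, b v w = b w v := fun v w => by
    simp only [hb, _root_.add_apply, _root_.sub_apply,
      _root_.smul_apply, ContinuousLinearMap.bilinearComp_apply,
      ContinuousLinearMap.mul_apply', smul_eq_mul]
    ring
  have hJ2 : jetTwoParam (𝔼 4) (𝔼 2) (A, B) = S := by
    rw [jetTwoParam_apply]
    show B + B.flip = S
    ext v w i
    simp only [hB, _root_.add_apply, _root_.smul_apply,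
      ContinuousLinearMap.flip_apply, hSvw, hbsymm w v, PiLp.add_apply, PiLp.smul_apply,
      smul_eq_mul]
    ring
  have hbk : ∀ v, b v (radVec a y) = χ' v := fun v => by
    simp only [hb, _root_.add_apply, _root_.sub_apply,
      _root_.smul_apply, ContinuousLinearMap.bilinearComp_apply,
      ContinuousLinearMap.mul_apply', smul_eq_mul, hκk]
    ring
  have hcN : ∀ v, (ℓA + c • ℓB) (N v) = ψ v := fun v => by
    simp only [hN, _root_.add_apply, ContinuousLinearMap.smulRight_apply,
      _root_.smul_apply, map_add, map_smul, map_sub, smul_eq_mul, hA1, hB1, hA2,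
      hB2]
    ring
  have hBN : ∀ v, ℓB (N v) = φ v := fun v => by
    simp only [hN, _root_.add_apply, ContinuousLinearMap.smulRight_apply, map_add,
      map_smul, map_sub, smul_eq_mul, hB1, hB2]
    ring
  have hcA : (ℓA + c • ℓB) uA = 1 := by
    simp only [_root_.add_apply, _root_.smul_apply, smul_eq_mul, hA1,
      hB1]
    ring
  rw [oneOneParam_apply, hJ1, hJ2]
  refine Prod.ext ?_ (Prod.ext ?_ ?_)
  · ext v
    exact hcN v
  · ext v
    rw [_root_.add_apply, ContinuousLinearMap.comp_apply,
      ContinuousLinearMap.flip_apply, hSvw, hbk, map_smul, hcA, _root_.smul_apply,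
      ContinuousLinearMap.comp_apply, hBN]
    simp only [hχ', _root_.sub_apply, _root_.smul_apply, smul_eq_mul]
    ring
  · show ℓB (N (radVec a y)) = ρ
    rw [hBN, hφ, _root_.smul_apply, hκk, smul_eq_mul, mul_one]

/-! ### Second-order genericity: almost every quadratic perturbation -/

/-- **Thom's transversality theorem for the 2-jet and the stratum `S_{1,1}`, Sard form, for maps
`ℝ⁴ → ℝ²`** (Golubitsky–Guillemin 1973, Ch. II Thm. 4.9 for `j²`, with Ch. VI §4–§5, Boardman's
Thm. 5.2: `j²f ⋔ S_{1,1}` is generic; here of full measure in the quadratic family, in the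
incidence chart `(ℓ_A + c ℓ_B, e_a + ∑ yᵢ e_{a↑i})` of covectors and directions).  Let
`f : ℝ⁴ ⊇ Ω → ℝ²` be `C^∞` on the open set `Ω` and `(ℓ_A, ℓ_B)`, `(u_A, u_B)` dual bases of
`(ℝ²)*`, `ℝ²`.  Then for almost every `θ = (A, B)` (any additive Haar measure on
`Hom(ℝ⁴, ℝ²) × Bil(ℝ⁴ × ℝ⁴, ℝ²)`), at every zero `u = (x, c, y, τ)` with `x ∈ Ω` of the incidence
system `G` of `S_{1,1}` for `g = f + A + B(·, ·)` the differential `D_u G : ℝ⁹ → ℝ⁹` is onto.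
Proof: parametric transversality (Hirsch 1976, Thm. 3.2.7 — the tree's
`ParametricTransversality.ae_surjective_fderiv_section`) for `(θ, u) ↦ G_{f+θ}(u)`, whose
parameter derivative is onto at every point (`surjective_oneOneParam`).
[cite: GolubitskyGuillemin1973, Ch. II §4, Thm. 4.9; Ch. VI §4; Ch. VI §5, Thm. 5.2]
[cite: HirschDT1976, Ch. 3 §2, Thm. 2.7] [cite: BaykurSaeki2017, §2.1, p. 6] -/
theorem ae_surjective_fderiv_oneOneSystem (μ : Measure P₂) [μ.IsAddHaarMeasure]
    {f : 𝔼 4 → 𝔼 2} {Ω : Set (𝔼 4)} (hΩ : IsOpen Ω) (hf : ContDiffOn ℝ ∞ f Ω)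
    {ℓA ℓB : (𝔼 2) →L[ℝ] ℝ} {uA uB : 𝔼 2} (hA1 : ℓA uA = 1) (hB1 : ℓB uA = 0)
    (hA2 : ℓA uB = 0) (hB2 : ℓB uB = 1) (a : Fin 4) :
    ∀ᵐ θ ∂μ, ∀ u : Unknowns, u.1 ∈ Ω → oneOneSystem ℓA ℓB a (quadPerturb f θ) u = 0 →
      Surjective (fderiv ℝ (oneOneSystem ℓA ℓB a (quadPerturb f θ)) u) := by
  set G : P₂ × Unknowns → Values := fun z => oneOneSystem ℓA ℓB a (quadPerturb f z.1) z.2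
    with hG
  set Ω' : Set (P₂ × Unknowns) := univ ×ˢ (Ω ×ˢ univ) with hΩ'
  have hΩ'o : IsOpen Ω' := isOpen_univ.prod (hΩ.prod isOpen_univ)
  have hGs : ContDiffOn ℝ ∞ G Ω' := contDiffOn_oneOneSystem hΩ hf ℓA ℓB a
  -- the parameter derivative is onto at every point of `Ω'`
  have h₁ : ∀ z ∈ Ω', G z = 0 →
      Surjective (fderiv ℝ G z ∘L ContinuousLinearMap.inl ℝ P₂ Unknowns) := by
    intro z hz _
    have hd : HasFDerivAt G (fderiv ℝ G z) z :=
      ((hGs.contDiffAt (hΩ'o.mem_nhds hz)).differentiableAt (by simp)).hasFDerivAt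
    have hsec : HasFDerivAt (fun p : P₂ => G (p, z.2))
        (oneOneParam ℓA ℓB a z.2.1 z.2.2.1 z.2.2.2.1 z.2.2.2.2) z.1 :=
      hasFDerivAt_oneOneSystem_param hΩ hf ℓA ℓB a hz.2.1 _ _ _ z.1
    rw [← (hasFDerivAt_curry_left hd).fderiv, hsec.fderiv]
    exact surjective_oneOneParam hA1 hB1 hA2 hB2 _ _ _ _ _
  have hae := ae_surjective_fderiv_section μ hΩ'o hGs h₁
  filter_upwards [hae] with θ hθ u hu h0
  exact hθ u ⟨mem_univ _, hu, mem_univ _⟩ h0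

/-! ### First-order genericity of the same family -/

/-- **For almost every `θ` the differential of `f + A + B(·,·)` vanishes nowhere on `Ω`**
(`dim ℝ⁴ = 4 < 8 = dim Hom(ℝ⁴, ℝ²)`: the stratum `{dg = 0}` is missed; GG II.4.9 with VI.1.1, as
in `OneJet.ae_fderiv_perturb_ne_zero` for the linear family).  The parameter derivative of the
1-jet, `(Ȧ, Ḃ) ↦ Ȧ + Ḃx + Ḃᵀx`, is onto (`Ḃ = 0`).
[cite: GolubitskyGuillemin1973, Ch. II §4, Thm. 4.9; Ch. VI §1, Prop. 1.1]
[cite: HirschDT1976, Ch. 3 §2, Thm. 2.7] -/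
theorem ae_fderiv_quadPerturb_ne_zero (μ : Measure P₂) [μ.IsAddHaarMeasure]
    {f : 𝔼 4 → 𝔼 2} {Ω : Set (𝔼 4)} (hΩ : IsOpen Ω) (hf : ContDiffOn ℝ ∞ f Ω) :
    ∀ᵐ θ ∂μ, ∀ x ∈ Ω, fderiv ℝ (quadPerturb f θ) x ≠ 0 := by
  set G : P₂ × 𝔼 4 → (𝔼 4 →L[ℝ] 𝔼 2) := fun z => fderiv ℝ (quadPerturb f z.1) z.2 with hG
  have hΩ' : IsOpen ((univ : Set P₂) ×ˢ Ω) := isOpen_univ.prod hΩ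
  have hGs : ContDiffOn ℝ ∞ G (univ ×ˢ Ω) := contDiffOn_fderiv_quadPerturb hΩ hf
  have h₁ : ∀ z ∈ (univ : Set P₂) ×ˢ Ω, G z = 0 →
      Surjective (fderiv ℝ G z ∘L ContinuousLinearMap.inl ℝ P₂ (𝔼 4)) := by
    intro z hz _
    have hd : HasFDerivAt G (fderiv ℝ G z) z :=
      ((hGs.contDiffAt (hΩ'.mem_nhds hz)).differentiableAt (by simp)).hasFDerivAt
    have hsec : HasFDerivAt (fun p : P₂ => G (p, z.2)) (jetOneParam (F := 𝔼 2) z.2) z.1 :=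
      hasFDerivAt_fderiv_quadPerturb_param hΩ hf hz.2 z.1
    rw [← (hasFDerivAt_curry_left hd).fderiv, hsec.fderiv]
    intro A
    exact ⟨(A, 0), by simp [jetOneParam_apply]⟩
  have hae := ae_forall_ne_zero_of_finrank_lt μ hΩ' hGs h₁ finrank_euclideanFour_lt
  filter_upwards [hae] with p hp x hx
  exact hp x ⟨mem_univ _, hx⟩

set_option maxHeartbeats 400000 in
/-- **For almost every `θ` the map `f + A + B(·,·)` is 1-jet-transverse at every point of `Ω`**
(GG II.4.9 with VI Def. 1.5 / Prop. 3.7; as `OneJet.ae_isOneJetTransverseAt_perturb` for the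
linear family): parametric transversality for the incidence map `(θ, x, ℓ) ↦ ℓ ∘ dg_x` on
`Ω × ((ℝ²)* ∖ 0)`, whose parameter derivative `(Ȧ, Ḃ) ↦ ℓ ∘ (Ȧ + Ḃx + Ḃᵀx)` is onto `(ℝ⁴)*`
(`Ȧ := φ ⊗ u`, `ℓ u = 1`, `Ḃ = 0`), then `eq_zero_of_surjective_incidence` at each zero.
[cite: GolubitskyGuillemin1973, Ch. II §4, Thm. 4.9; Ch. VI §1, Def. 1.5; Ch. VI §3, Prop. 3.7]
[cite: HirschDT1976, Ch. 3 §2, Thm. 2.7] -/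
theorem ae_isOneJetTransverseAt_quadPerturb (μ : Measure P₂) [μ.IsAddHaarMeasure]
    {f : 𝔼 4 → 𝔼 2} {Ω : Set (𝔼 4)} (hΩ : IsOpen Ω) (hf : ContDiffOn ℝ ∞ f Ω) :
    ∀ᵐ θ ∂μ, ∀ x ∈ Ω, IsOneJetTransverseAt (quadPerturb f θ) x := by
  -- the incidence map `G(θ, (x, ℓ)) = ℓ ∘ d(f + θ)_x`
  set G : P₂ × (𝔼 4 × ((𝔼 2) →L[ℝ] ℝ)) → (𝔼 4 →L[ℝ] ℝ) :=
    fun z => z.2.2.comp (fderiv ℝ (quadPerturb f z.1) z.2.1) with hG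
  set Ω' : Set (P₂ × (𝔼 4 × ((𝔼 2) →L[ℝ] ℝ))) := univ ×ˢ (Ω ×ˢ {ℓ | ℓ ≠ 0}) with hΩ'
  have hΩ'o : IsOpen Ω' := isOpen_univ.prod (hΩ.prod isOpen_ne)
  -- smoothness of `G` on `Ω'`
  have hM : ContDiffOn ℝ ∞ (fun z : P₂ × (𝔼 4 × ((𝔼 2) →L[ℝ] ℝ)) =>
      fderiv ℝ (quadPerturb f z.1) z.2.1) Ω' := by
    have hπ : ContDiff ℝ ∞ fun z : P₂ × (𝔼 4 × ((𝔼 2) →L[ℝ] ℝ)) => (z.1, z.2.1) :=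
      contDiff_fst.prodMk (contDiff_fst.comp contDiff_snd)
    have hπm : MapsTo (fun z : P₂ × (𝔼 4 × ((𝔼 2) →L[ℝ] ℝ)) => (z.1, z.2.1)) Ω' (univ ×ˢ Ω) :=
      fun z hz => ⟨mem_univ _, hz.2.1⟩
    have h := (contDiffOn_fderiv_quadPerturb hΩ hf).comp hπ.contDiffOn hπm
    exact h
  have hGs : ContDiffOn ℝ ∞ G Ω' := (contDiff_snd.comp contDiff_snd).contDiffOn.clm_comp hM
  -- the parameter derivative is onto at every point of `Ω'`
  have h₁ : ∀ z ∈ Ω', G z = 0 →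
      Surjective (fderiv ℝ G z ∘L
        ContinuousLinearMap.inl ℝ P₂ (𝔼 4 × ((𝔼 2) →L[ℝ] ℝ))) := by
    intro z hz _
    have hd : HasFDerivAt G (fderiv ℝ G z) z :=
      ((hGs.contDiffAt (hΩ'o.mem_nhds hz)).differentiableAt (by simp)).hasFDerivAt
    set Lc := ContinuousLinearMap.compL ℝ (𝔼 4) (𝔼 2) ℝ z.2.2 with hLc
    have hsec : HasFDerivAt (fun q : P₂ => G (q, z.2)) (Lc.comp (jetOneParam (F := 𝔼 2) z.2.1))
        z.1 := by
      have h := Lc.hasFDerivAt.comp z.1 (hasFDerivAt_fderiv_quadPerturb_param hΩ hf hz.2.1 z.1)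
      exact h
    rw [← (hasFDerivAt_curry_left hd).fderiv, hsec.fderiv]
    obtain ⟨u, hu⟩ := exists_apply_eq_one hz.2.2
    intro φ
    refine ⟨(φ.smulRight u, 0), ?_⟩
    ext v
    simp [hLc, jetOneParam_apply, ContinuousLinearMap.compL_apply, hu]
  have hae := ae_surjective_fderiv_section μ hΩ'o hGs h₁
  filter_upwards [hae] with θ hθ x hx
  intro ℓ hℓ hcomp k hk hv
  have hz : (θ, (x, ℓ)) ∈ Ω' := ⟨mem_univ _, hx, hℓ⟩
  have h0 : G (θ, (x, ℓ)) = 0 := hcomp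
  have hsurj := hθ (x, ℓ) hz h0
  -- the derivative of `(x, ℓ) ↦ ℓ ∘ dg_x` at `(x, ℓ)` is `(v, λ) ↦ ℓ ∘ D²g(x) v + λ ∘ dg_x`
  -- (no `set g := quadPerturb f θ`: abstracting the map makes the elaboration below time out)
  have hgs : ContDiffOn ℝ ∞ (quadPerturb f θ) Ω := contDiffOn_quadPerturb hf θ
  have hg' : ContDiffOn ℝ ∞ (fderiv ℝ (quadPerturb f θ)) Ω := hgs.fderiv_of_isOpen hΩ (by simp)
  have hdg : HasFDerivAt (fderiv ℝ (quadPerturb f θ))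
      (fderiv ℝ (fderiv ℝ (quadPerturb f θ)) x) x :=
    ((hg'.contDiffAt (hΩ.mem_nhds hx)).differentiableAt (by simp)).hasFDerivAt
  have hd : HasFDerivAt (fun y : 𝔼 4 × ((𝔼 2) →L[ℝ] ℝ) => fderiv ℝ (quadPerturb f θ) y.1)
      ((fderiv ℝ (fderiv ℝ (quadPerturb f θ)) x).comp
        (ContinuousLinearMap.fst ℝ (𝔼 4) ((𝔼 2) →L[ℝ] ℝ))) (x, ℓ) :=
    hdg.comp (x, ℓ) hasFDerivAt_fst
  have hc : HasFDerivAt (fun y : 𝔼 4 × ((𝔼 2) →L[ℝ] ℝ) => y.2)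
      (ContinuousLinearMap.snd ℝ (𝔼 4) ((𝔼 2) →L[ℝ] ℝ)) (x, ℓ) := hasFDerivAt_snd
  have hT := hc.clm_comp hd
  have hTeq : fderiv ℝ (fun y : 𝔼 4 × ((𝔼 2) →L[ℝ] ℝ) => G (θ, y)) (x, ℓ) =
      (ContinuousLinearMap.compL ℝ (𝔼 4) (𝔼 2) ℝ ℓ).comp
          ((fderiv ℝ (fderiv ℝ (quadPerturb f θ)) x).comp
            (ContinuousLinearMap.fst ℝ (𝔼 4) ((𝔼 2) →L[ℝ] ℝ))) +
        ((ContinuousLinearMap.compL ℝ (𝔼 4) (𝔼 2) ℝ).flip (fderiv ℝ (quadPerturb f θ) x)).comp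
          (ContinuousLinearMap.snd ℝ (𝔼 4) ((𝔼 2) →L[ℝ] ℝ)) := hT.fderiv
  rw [hTeq] at hsurj
  refine eq_zero_of_surjective_incidence (g := quadPerturb f θ) (ℓ := ℓ) ?_ hk hv
  intro φ
  obtain ⟨vl, hvl⟩ := hsurj φ
  refine ⟨vl, ?_⟩
  rw [← hvl]
  simp [ContinuousLinearMap.compL_apply]

/-! ### Everything at once, in all the incidence charts; small generic perturbations exist -/

/-- The `i`-th coordinate covector of `ℝ²` takes the value `δᵢⱼ` on the `j`-th basis vector.
[folklore] -/
theorem proj_single_two (i j : Fin 2) :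
    (EuclideanSpace.proj i : (𝔼 2) →L[ℝ] ℝ) (EuclideanSpace.single j (1 : ℝ)) =
      if i = j then 1 else 0 := by
  fin_cases i <;> fin_cases j <;> simp

/-- **Second-order genericity after almost every quadratic perturbation, all charts at once.**
For almost every `θ = (A, B)`: `g = f + A + B(·,·)` has nowhere-vanishing differential on `Ω`, is
1-jet-transverse at every point of `Ω`, and for each of the `4 × 2` incidence charts (direction
chart `a : Fin 4`; covector charts `(e₀*, e₁*)` and `(e₁*, e₀*)`) every zero over `Ω` of the
incidence system of `S_{1,1}` is nondegenerate.  (Every degenerate critical point of a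
1-jet-transverse `g` with `dg ≠ 0` is seen by one of these charts: normalise a coordinate of the
radical direction and the leading coefficient of the cokernel covector.)
[cite: GolubitskyGuillemin1973, Ch. II §4, Thm. 4.9; Ch. VI §4; Ch. VI §5, Thm. 5.2]
[cite: HirschDT1976, Ch. 3 §2, Thm. 2.7] [cite: BaykurSaeki2017, §2.1, p. 6] -/
theorem ae_twoGeneric_quadPerturb (μ : Measure P₂) [μ.IsAddHaarMeasure]
    {f : 𝔼 4 → 𝔼 2} {Ω : Set (𝔼 4)} (hΩ : IsOpen Ω) (hf : ContDiffOn ℝ ∞ f Ω) :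
    ∀ᵐ θ ∂μ, (∀ x ∈ Ω, fderiv ℝ (quadPerturb f θ) x ≠ 0 ∧
        IsOneJetTransverseAt (quadPerturb f θ) x) ∧
      ∀ a : Fin 4, ∀ i : Fin 2, ∀ u : Unknowns, u.1 ∈ Ω →
        oneOneSystem (EuclideanSpace.proj i) (EuclideanSpace.proj (i + 1)) a
            (quadPerturb f θ) u = 0 →
          Surjective (fderiv ℝ (oneOneSystem (EuclideanSpace.proj i)
            (EuclideanSpace.proj (i + 1)) a (quadPerturb f θ)) u) := by
  have hchart : ∀ i : Fin 2,
      (EuclideanSpace.proj i : (𝔼 2) →L[ℝ] ℝ) (EuclideanSpace.single i (1 : ℝ)) = 1 ∧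
      (EuclideanSpace.proj (i + 1) : (𝔼 2) →L[ℝ] ℝ) (EuclideanSpace.single i (1 : ℝ)) = 0 ∧
      (EuclideanSpace.proj i : (𝔼 2) →L[ℝ] ℝ) (EuclideanSpace.single (i + 1) (1 : ℝ)) = 0 ∧
      (EuclideanSpace.proj (i + 1) : (𝔼 2) →L[ℝ] ℝ) (EuclideanSpace.single (i + 1) (1 : ℝ))
        = 1 := by
    intro i
    fin_cases i <;> simp
  have hsys : ∀ a : Fin 4, ∀ i : Fin 2, ∀ᵐ θ ∂μ, ∀ u : Unknowns, u.1 ∈ Ω →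
      oneOneSystem (EuclideanSpace.proj i) (EuclideanSpace.proj (i + 1)) a
          (quadPerturb f θ) u = 0 →
        Surjective (fderiv ℝ (oneOneSystem (EuclideanSpace.proj i)
          (EuclideanSpace.proj (i + 1)) a (quadPerturb f θ)) u) := fun a i =>
    ae_surjective_fderiv_oneOneSystem μ hΩ hf (hchart i).1 (hchart i).2.1 (hchart i).2.2.1
      (hchart i).2.2.2 a
  have hsys' : ∀ᵐ θ ∂μ, ∀ a : Fin 4, ∀ i : Fin 2, ∀ u : Unknowns, u.1 ∈ Ω →
      oneOneSystem (EuclideanSpace.proj i) (EuclideanSpace.proj (i + 1)) a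
          (quadPerturb f θ) u = 0 →
        Surjective (fderiv ℝ (oneOneSystem (EuclideanSpace.proj i)
          (EuclideanSpace.proj (i + 1)) a (quadPerturb f θ)) u) := by
    rw [ae_all_iff]
    intro a
    rw [ae_all_iff]
    exact hsys a
  filter_upwards [ae_fderiv_quadPerturb_ne_zero μ hΩ hf,
    ae_isOneJetTransverseAt_quadPerturb μ hΩ hf, hsys'] with θ h1 h2 h3
  exact ⟨fun x hx => ⟨h1 x hx, h2 x hx⟩, h3⟩

/-- **Small second-order-generic quadratic perturbations exist**: for every `ε > 0` there is
`θ = (A, B)` with `‖θ‖ < ε` (so `‖A‖, ‖B‖ < ε`) such that `f + A + B(·,·)` has all the properties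
of `ae_twoGeneric_quadPerturb` on `Ω` (GG II.4.9: density; Milnor's "somewhere in every open
set" for a null complement). [cite: GolubitskyGuillemin1973, Ch. II §4, Thm. 4.9]
[cite: MilnorTDV1965, §3, Corollary p. 17] -/
theorem exists_norm_lt_twoGeneric {f : 𝔼 4 → 𝔼 2} {Ω : Set (𝔼 4)} (hΩ : IsOpen Ω)
    (hf : ContDiffOn ℝ ∞ f Ω) {ε : ℝ} (hε : 0 < ε) :
    ∃ θ : P₂, ‖θ‖ < ε ∧ (∀ x ∈ Ω, fderiv ℝ (quadPerturb f θ) x ≠ 0 ∧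
        IsOneJetTransverseAt (quadPerturb f θ) x) ∧
      ∀ a : Fin 4, ∀ i : Fin 2, ∀ u : Unknowns, u.1 ∈ Ω →
        oneOneSystem (EuclideanSpace.proj i) (EuclideanSpace.proj (i + 1)) a
            (quadPerturb f θ) u = 0 →
          Surjective (fderiv ℝ (oneOneSystem (EuclideanSpace.proj i)
            (EuclideanSpace.proj (i + 1)) a (quadPerturb f θ)) u) :=
  exists_norm_lt_of_ae (Measure.addHaar : Measure P₂) (ae_twoGeneric_quadPerturb _ hΩ hf) hε

end System

end OneJet

end Literature.Topology.FourManifolds
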